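/-
Copyright (c) 2026 the pub-hodgecm-mathlib formalisation cell (harness21).  Prover seat hodgecm-mathlib-F0P3a-p01 (g17): road «S3-ram» (LEAD F0P3a-plan (g13); owner∕table
F0P3a-p06 (g15)), the (a2) JUNCTION (J★) — organ (β) «THE HEAD BY CONFIGURATION»: the (J★) socket text modulo the S45 hyperbolic region row; 2026-09-02.
-/
import Literature.NumberTheory.Rogawski1990.DepthZeroKappaTransferTypeOneRamifiedSignedCountOfStrataCounts      -- ★ FILE 2 (A-p16 (g32), p847798): equilateral head of the strata counts
import Literature.NumberTheory.Rogawski1990.DepthZeroKappaTransferTypeOneRamifiedSignedCountIsoceles            -- ★ FILE 5 (A-p16 (g32), p848413): isoceles head of the strata counts + S45 rows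
import Literature.NumberTheory.Rogawski1990.DepthZeroKappaTransferTypeOneRamifiedJunctionStrataCountEquilateral -- ★ JUNCTION III (this seat, p847967): `strataCount_J₀_equilateral`
import Literature.NumberTheory.Rogawski1990.DepthZeroKappaTransferTypeOneRamifiedJunctionStrataCountIsoceles    -- ★ JUNCTION IV (this seat, p848026): `strataCount_J₀_isoceles`
import Literature.NumberTheory.Automorphic.UnitaryLatticeTreeIsocelesBareRootTokensRamified                    -- ★ S45 BARE (F0P3a-p02 (g17), p848124): `isoceles_bare_regionCard_and_tokenCounts`
import HarnessLib

/-!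
# The ramified type-(1) `κ`-orbital integral: THE JUNCTION HEAD BY CONFIGURATION, modulo the hyperbolic region row (Rogawski 1990 §4.9; Kottwitz 1986 §3;
# Labesse–Langlands 1979 §2, §5)

Topic `NumberTheory/Rogawski1990`; namespace `Literature.NumberTheory.Rogawski1990`.  THEOREMS ONLY (no definition, no instance, no notation, no named fact, no `sorry`);
kernel lane `--supports stmt-HodgeConjecture-24833`; datum-free over the abstract lattice model (`K : Type` with `Valued K ℤᵐ⁰`, involution `σ` with `σϖ = −ϖ`, residually
trivial, finite residue field of odd characteristic).  Cell `pub/hodgecm-mathlib` (D-0151), crux H413; road «S3-ram» (Literature seeding, count-neutral).  Fold of record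
v7.7–v7.10 socket (J★) `stub_typeOne_junction_ram` = the `hJ` hypothesis type of ★ p847532 `typeOne_signedClassSum_ram_of_junction` (F0P3b-p01), whose text is the junction
pen's statement-first v3 (F0P3a-p01 (g16), `DepthZeroKappaTransferTypeOneRamifiedSignedCount.sf.v3`, R-308 «=»).

* **`signedStrataCount_typeOne_ram_of_hyperbolic`**: the (J★) text — for the four ramified type-(1) literals `H_b = diag(ε^{b₁}u₀, ε^{b₂}u₁, ε^{b₁+b₂}u₂)` and the norm-one
  diagonal element `T = diag(α, u, γ)` (`≡ 1 (ϖ²)`, depths `N₁ = v(α−u)`, `N₂ = v(u−γ)`, `N = v(α−γ) = 2n+1`, `N₁ + N₂ = 2m`), the `κ`-signed five strata counts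
  `∀ j, Σ_b (−1)^{b₂}·n_{b,j} = χ((−1)^m·u₀u₂·A·C)·q^m·X̃_j(n)` — PROVED from ONE remaining hypothesis `hHyp`, the S45 HYPERBOLIC REGION ROW (F0P3a-p02's socket
  `row_S45_hyperbolic`, S45 v4 bc98a4a1 :46, binder text = ★ FILE 5's `hHyp` VERBATIM, at the head's `K σ ϖ` and placed FIRST), by cases on the configuration:
  `N₁ = N ∧ N₂ = N` (equilateral) is ★ FILE 2 `signedStrataCount_typeOne_ram_equilateral_of_strataCount` fed with ★ JUNCTION III `strataCount_J₀_equilateral` BY NAME;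
  otherwise (the two isoceles configurations and their mirror) it is ★ FILE 5 `signedStrataCount_typeOne_ram_isoceles_of_strataCount` fed with ★ JUNCTION IV
  `strataCount_J₀_isoceles`, `hHyp`, and ★ S45 BARE `isoceles_bare_regionCard_and_tokenCounts` BY NAME.  No text is restated: the head binders and conclusion are the
  sf v3 slice, `hHyp` is ★ FILE 5's binder slice; the proof is two `exact`s.
CONSUMPTION: once the hyperbolic row is a theorem `H` of the type of `hHyp` (HYP-PLAN v1 94da2402, organs (V0)–(V6), assembly (V5) F0P3a-p02 (g18)), the (J★) socket closes
by `hJ := fun {K} _ _ {σ} {ϖ} => @signedStrataCount_typeOne_ram_of_hyperbolic K _ _ σ ϖ (@H K _ _ σ ϖ)` (the binder telescope after `hHyp` IS the `hJ` telescope after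
its `{K : Type} [Field K] [Valued K ℤᵐ⁰] {σ} {ϖ}` prefix, VERBATIM) — equivalently by the ten-line corollary this seat files the moment `H` lands.
HONEST LABEL: HC_CM is proved only modulo the 2 remaining named inputs (hLiu418 24832, h413 24833) until rung 0 closes; this file proves an implication and asserts
nothing about the hyperbolic row.

## References
* [Rogawski1990] J. D. Rogawski, *Automorphic Representations of Unitary Groups in Three Variables*, Ann. of Math. Stud. 123 (1990), §4.9 Prop. 4.9.1 (a)(b) p. 55, Lemma 4.9.3.
* [Kottwitz1986] R. E. Kottwitz, *Base change for unit elements of Hecke algebras*, Compositio Math. 60 (1986), §3 (counting fixed lattices shell by shell).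
* [LabesseLanglands1979] J.-P. Labesse, R. P. Langlands, *L-indistinguishability for SL(2)*, Canad. J. Math. 31 (1979), §2 Lemma 2.1, §5 (κ-signed sums over the four twists).
-/

set_option autoImplicit false

noncomputable section

open scoped Valued WithZero Matrix MatrixGroups
open Polynomial Finset Classical
open Literature.NumberTheory.Automorphic Literature.NumberTheory.Automorphic.HermitianLattice Literature.NumberTheory.Automorphic.UnitaryLatticeTree

namespace Literature.NumberTheory.Rogawski1990

set_option maxHeartbeats 1600000 in
/-- **The (J★) junction head modulo the hyperbolic region row.**  For the four ramified type-(1) literals and a norm-one diagonal element `T = diag(α, u, γ) ≡ 1 (ϖ²)`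
with depths `N₁ + N₂ = 2m`, `N = 2n + 1`, the `κ`-signed five strata counts equal `χ((−1)^m·u₀u₂AC)·q^m·X̃(n)` — given the S45 hyperbolic region row `hHyp` (stated first, at
the head's `K σ ϖ`).  Equilateral configurations: ★ `signedStrataCount_typeOne_ram_equilateral_of_strataCount` ∘ ★ `TypeOneRamifiedJunction.strataCount_J₀_equilateral`; isoceles
configurations: ★ `signedStrataCount_typeOne_ram_isoceles_of_strataCount` ∘ ★ `TypeOneRamifiedJunction.strataCount_J₀_isoceles` ∘ `hHyp` ∘ ★ `isoceles_bare_regionCard_and_tokenCounts`.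
[cite: Rogawski1990, §4.9 Prop. 4.9.1 (a) p. 55] [cite: Kottwitz1986, §3] [cite: LabesseLanglands1979, §2 Lemma 2.1] -/
theorem signedStrataCount_typeOne_ram_of_hyperbolic
    {K : Type} [Field K] [Valued K ℤᵐ⁰] {σ : K →+* K} {ϖ : K}
    -- the S45 HYPERBOLIC REGION ROW (F0P3a-p02 socket `row_S45_hyperbolic`, S45 v4 bc98a4a1 :46; binder text = ★ FILE 5 `hHyp` VERBATIM)
    (hHyp : ∀ [ValuativeRel K] [(Valued.v : Valuation K ℤᵐ⁰).Compatible]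
    (hσ : ∀ x, σ (σ x) = x) (hvσ : ∀ a, Valued.v (σ a) = Valued.v a) (hσϖ : σ ϖ = -ϖ)
    (hϖ : Valued.v ϖ = WithZero.exp (-1 : ℤ)) (hres : ∀ x : K, Valued.v x ≤ 1 → Valued.v (σ x - x) < 1) (h2 : Valued.v (2 : K) = 1)
    (hnorm : ∀ u : K, σ u = u → Valued.v (u - 1) < 1 → ∃ z : K, z * σ z = u ∧ Valued.v (z - 1) ≤ Valued.v (u - 1)) [Fintype 𝓀[K]] [DecidableEq 𝓀[K]]
    {γ : unitaryGroupOfForm σ ((StdForm.antidiagonal 3).over K)} (hγ0 : γ ∈ unitaryInt σ ((StdForm.antidiagonal 3).over K))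
    (d : Fin 3 → K) (hd : ∀ i, Valued.v (d i) = 1) (hdσ : ∀ i, σ (d i) = d i)
    (A : GL (Fin 3) K) (hA : IsIntMatrix (A : Matrix (Fin 3) (Fin 3) K)) (hA' : IsIntMatrix ((A⁻¹ : GL (Fin 3) K) : Matrix (Fin 3) (Fin 3) K))
    (hdA : Matrix.diagonal d = (-(Matrix.diagonal d).det) • formCongr σ A ((StdForm.antidiagonal 3).over K))
    (s : Fin 3 → K) (hs1 : s 1 = 1) (hsv : ∀ i, Valued.v (s i) = 1) (hsσ : ∀ i, s i * σ (s i) = 1)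
    (hγA : ((γ : GL (Fin 3) K) : Matrix (Fin 3) (Fin 3) K) = (A : Matrix (Fin 3) (Fin 3) K) * Matrix.diagonal s * ((A⁻¹ : GL (Fin 3) K) : Matrix (Fin 3) (Fin 3) K))
    (i₀ : Fin 3) {d₀ : ℕ} (hd3 : 3 ≤ d₀) (he : ∀ i, Valued.v (s i - 1) ≤ Valued.v ϖ ^ d₀)
    (hiso : ∀ j, j ≠ i₀ → Valued.v (s i₀ - s j) = Valued.v ϖ ^ d₀) (hclose : ∀ j k, j ≠ i₀ → k ≠ i₀ → Valued.v (s j - s k) ≤ Valued.v ϖ ^ (d₀ + 2))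
    (hreg : ∀ i j, i ≠ j → s i ≠ s j)
    (mA : ℕ) (hmA : d₀ = 2 * mA + 3)
    (c₁ ε : K) (hc₁ : Valued.v c₁ = 1) (hεv : Valued.v ε = 1) (hε : ∀ z : K, Valued.v z ≤ 1 → Valued.v (z ^ 2 - ε) = 1)
    (q : ℕ) (hq : q = Fintype.card 𝓀[K])
    (sR : Finset {M : Submodule 𝒪[K] (Fin 3 → K) // IsVertex σ ϖ ((StdForm.antidiagonal 3).over K) M}) (hsR : ∀ v, v ∈ sR ↔ v ∈ {v : {M : Submodule 𝒪[K] (Fin 3 → K) // IsVertex σ ϖ ((StdForm.antidiagonal 3).over K) M} | latticeGraphIso σ ϖ ((StdForm.antidiagonal 3).over K) γ v = v ∧ IsSelfDualLattice σ ϖ ((StdForm.antidiagonal 3).over K) v.1 ∧ v.1.map ((Matrix.toLin' (((γ : GL (Fin 3) K) : Matrix (Fin 3) (Fin 3) K) - 1)).restrictScalars 𝒪[K]) ≤ scaleLattice (ϖ ^ d₀) v.1})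
    (s' : ℕ) (hs' : 1 ≤ s') (hgap : ∀ j k, j ≠ i₀ → k ≠ i₀ → j ≠ k → Valued.v (s j - s k) = Valued.v ϖ ^ (d₀ + 2 * s'))
    {j k : Fin 3} (hj : j ≠ i₀) (hk : k ≠ i₀) (hjk : j ≠ k)
    (hhyp : ∃ t : K, Valued.v t = 1 ∧ Valued.v (d j + t * σ t * d k) < 1),
      sR.card = 1 + 2 * q * ∑ i ∈ Finset.range s', q ^ i ∧
    ∑ v ∈ sR, ({w | w ∈ {w | ∃ c, ((latticeGraph σ ϖ ((StdForm.antidiagonal 3).over K)).Adj v c ∧ (latticeGraph σ ϖ ((StdForm.antidiagonal 3).over K)).dist ⟨stdLattice K 3, 0, isSelfDualLattice_stdLattice_three_of_v hϖ⟩ c = (latticeGraph σ ϖ ((StdForm.antidiagonal 3).over K)).dist ⟨stdLattice K 3, 0, isSelfDualLattice_stdLattice_three_of_v hϖ⟩ v + 1 ∧ latticeGraphIso σ ϖ ((StdForm.antidiagonal 3).over K) γ c = c) ∧ ((latticeGraph σ ϖ ((StdForm.antidiagonal 3).over K)).Adj c w ∧ (latticeGraph σ ϖ ((StdForm.antidiagonal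 3).over K)).dist ⟨stdLattice K 3, 0, isSelfDualLattice_stdLattice_three_of_v hϖ⟩ w = (latticeGraph σ ϖ ((StdForm.antidiagonal 3).over K)).dist ⟨stdLattice K 3, 0, isSelfDualLattice_stdLattice_three_of_v hϖ⟩ c + 1 ∧ latticeGraphIso σ ϖ ((StdForm.antidiagonal 3).over K) γ w = w)} ∧ (¬ w.1.map ((Matrix.toLin' (((γ : GL (Fin 3) K) : Matrix (Fin 3) (Fin 3) K) - 1)).restrictScalars 𝒪[K]) ≤ scaleLattice (ϖ ^ d₀) w.1 ∧ (w.1.map ((Matrix.toLin' (((γ : GL (Fin 3) K) : Matrix (Fin 3) (Fin 3) K) - 1)).restrictScalars 𝒪[K]) ≤ scaleLattice (ϖ ^ (d₀ - 1)) w.1 ∧ ¬ w.1.map ((Matrix.toLin' (((γ : GL (Fin 3) K) : Matrix (Fin 3) (Fin 3) K) - 1)).restrictScalars 𝒪[K]) ≤ scaleLattice (ϖ ^ d₀) w.1))}).ncard = q * (if (∃ t : K, Valued.v t = 1 ∧ Valued.v (t ^ 2 - ((-1) ^ (s' + 1) * ((ϖ ^ d₀)⁻¹ * (s i₀ - s j))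 * ((ϖ ^ (d₀ + 2 * s'))⁻¹ * (s k - s j)) * (d i₀ * d k))) < 1) then 4 * q ^ s' else 0) ∧
    ∑ v ∈ sR, ({w | w ∈ {w | ∃ c, ((latticeGraph σ ϖ ((StdForm.antidiagonal 3).over K)).Adj v c ∧ (latticeGraph σ ϖ ((StdForm.antidiagonal 3).over K)).dist ⟨stdLattice K 3, 0, isSelfDualLattice_stdLattice_three_of_v hϖ⟩ c = (latticeGraph σ ϖ ((StdForm.antidiagonal 3).over K)).dist ⟨stdLattice K 3, 0, isSelfDualLattice_stdLattice_three_of_v hϖ⟩ v + 1 ∧ latticeGraphIso σ ϖ ((StdForm.antidiagonal 3).over K) γ c = c) ∧ ((latticeGraph σ ϖ ((StdForm.antidiagonal 3).over K)).Adj c w ∧ (latticeGraph σ ϖ ((StdForm.antidiagonal 3).over K)).dist ⟨stdLattice K 3, 0, isSelfDualLattice_stdLattice_three_of_v hϖ⟩ w = (latticeGraph σ ϖ ((StdForm.antidiagonal 3).over K)).dist ⟨stdLattice K 3, 0, isSelfDualLattice_stdLattice_three_of_v hϖ⟩ c + 1 ∧ latticeGraphIso σ ϖ ((StdForm.antidiagonal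 3).over K) γ w = w)} ∧ (¬ w.1.map ((Matrix.toLin' (((γ : GL (Fin 3) K) : Matrix (Fin 3) (Fin 3) K) - 1)).restrictScalars 𝒪[K]) ≤ scaleLattice (ϖ ^ d₀) w.1 ∧ (w.1.map ((Matrix.toLin' (((γ : GL (Fin 3) K) : Matrix (Fin 3) (Fin 3) K) - 1)).restrictScalars 𝒪[K]) ≤ scaleLattice (ϖ ^ (d₀ - 2)) w.1 ∧ ¬ w.1.map ((Matrix.toLin' (((γ : GL (Fin 3) K) : Matrix (Fin 3) (Fin 3) K) - 1)).restrictScalars 𝒪[K]) ≤ scaleLattice (ϖ ^ (d₀ - 1)) w.1) ∧ ∃ y ∈ w.1, ∃ a : K, Valued.v a = 1 ∧ Valued.v ((ϖ ^ (d₀ - 2))⁻¹ * pairing σ ((StdForm.antidiagonal 3).over K) y ((((γ : GL (Fin 3) K) : Matrix (Fin 3) (Fin 3) K) - 1) *ᵥ y) - (c₁) * a ^ 2) < 1)}).ncard = q * (if (∃ a : K, Valued.v a = 1 ∧ Valued.v (((ϖ ^ d₀)⁻¹ * (s i₀ - s j) * (d i₀ * (-(Matrix.diagonal d).det)⁻¹))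 + c₁ * a ^ 2) < 1) then (if (∃ t : K, Valued.v t = 1 ∧ Valued.v (t ^ 2 - ((-1) ^ (s' + 1) * ((ϖ ^ d₀)⁻¹ * (s i₀ - s j)) * ((ϖ ^ (d₀ + 2 * s'))⁻¹ * (s k - s j)) * (d i₀ * d k))) < 1) then (q - 1) * (1 + 2 * q * ∑ i ∈ Finset.range (s' - 1), q ^ i) + q ^ s' * (q - 3) else (q - 1) * (1 + 2 * q * ∑ i ∈ Finset.range (s' - 1), q ^ i) + q ^ s' * (q - 1)) else (if (∃ t : K, Valued.v t = 1 ∧ Valued.v (t ^ 2 - ((-1) ^ (s' + 1) * ((ϖ ^ d₀)⁻¹ * (s i₀ - s j)) * ((ϖ ^ (d₀ + 2 * s'))⁻¹ * (s k - s j)) * (d i₀ * d k))) < 1) then q ^ s' * (q - 1) else q ^ s' * (q + 1))) ∧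
    ∑ v ∈ sR, ({w | w ∈ {w | ∃ c, ((latticeGraph σ ϖ ((StdForm.antidiagonal 3).over K)).Adj v c ∧ (latticeGraph σ ϖ ((StdForm.antidiagonal 3).over K)).dist ⟨stdLattice K 3, 0, isSelfDualLattice_stdLattice_three_of_v hϖ⟩ c = (latticeGraph σ ϖ ((StdForm.antidiagonal 3).over K)).dist ⟨stdLattice K 3, 0, isSelfDualLattice_stdLattice_three_of_v hϖ⟩ v + 1 ∧ latticeGraphIso σ ϖ ((StdForm.antidiagonal 3).over K) γ c = c) ∧ ((latticeGraph σ ϖ ((StdForm.antidiagonal 3).over K)).Adj c w ∧ (latticeGraph σ ϖ ((StdForm.antidiagonal 3).over K)).dist ⟨stdLattice K 3, 0, isSelfDualLattice_stdLattice_three_of_v hϖ⟩ w = (latticeGraph σ ϖ ((StdForm.antidiagonal 3).over K)).dist ⟨stdLattice K 3, 0, isSelfDualLattice_stdLattice_three_of_v hϖ⟩ c + 1 ∧ latticeGraphIso σ ϖ ((StdForm.antidiagonal 3).over K) γ w = w)} ∧ (¬ w.1.map ((Matrix.toLin' (((γ : GL (Fin 3) K) : Matrix (Fin 3) (Fin 3)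 K) - 1)).restrictScalars 𝒪[K]) ≤ scaleLattice (ϖ ^ d₀) w.1 ∧ (w.1.map ((Matrix.toLin' (((γ : GL (Fin 3) K) : Matrix (Fin 3) (Fin 3) K) - 1)).restrictScalars 𝒪[K]) ≤ scaleLattice (ϖ ^ (d₀ - 2)) w.1 ∧ ¬ w.1.map ((Matrix.toLin' (((γ : GL (Fin 3) K) : Matrix (Fin 3) (Fin 3) K) - 1)).restrictScalars 𝒪[K]) ≤ scaleLattice (ϖ ^ (d₀ - 1)) w.1) ∧ ¬ (∃ y ∈ w.1, ∃ a : K, Valued.v a = 1 ∧ Valued.v ((ϖ ^ (d₀ - 2))⁻¹ * pairing σ ((StdForm.antidiagonal 3).over K) y ((((γ : GL (Fin 3) K) : Matrix (Fin 3) (Fin 3) K) - 1) *ᵥ y) - (c₁) * a ^ 2) < 1))}).ncard = q * (if (∃ a : K, Valued.v a = 1 ∧ Valued.v (((ϖ ^ d₀)⁻¹ * (s i₀ - s j) * (d i₀ * (-(Matrix.diagonal d).det)⁻¹)) + c₁ * a ^ 2) < 1) then (if (∃ t : K, Valued.v t = 1 ∧ Valued.v (t ^ 2 - ((-1) ^ (s'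 + 1) * ((ϖ ^ d₀)⁻¹ * (s i₀ - s j)) * ((ϖ ^ (d₀ + 2 * s'))⁻¹ * (s k - s j)) * (d i₀ * d k))) < 1) then q ^ s' * (q - 1) else q ^ s' * (q + 1)) else (if (∃ t : K, Valued.v t = 1 ∧ Valued.v (t ^ 2 - ((-1) ^ (s' + 1) * ((ϖ ^ d₀)⁻¹ * (s i₀ - s j)) * ((ϖ ^ (d₀ + 2 * s'))⁻¹ * (s k - s j)) * (d i₀ * d k))) < 1) then (q - 1) * (1 + 2 * q * ∑ i ∈ Finset.range (s' - 1), q ^ i) + q ^ s' * (q - 3) else (q - 1) * (1 + 2 * q * ∑ i ∈ Finset.range (s' - 1), q ^ i) + q ^ s' * (q - 1))))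
    (hσ : ∀ x, σ (σ x) = x) (hvσ : ∀ a, Valued.v (σ a) = Valued.v a) (hϖ : Valued.v ϖ = WithZero.exp (-1 : ℤ)) (hσϖ : σ ϖ = -ϖ)
    (hres : ∀ x : K, Valued.v x ≤ 1 → Valued.v (σ x - x) < 1) (h2 : Valued.v (2 : K) = 1)
    (hnorm : ∀ u : K, σ u = u → Valued.v (u - 1) < 1 → ∃ z : K, z * σ z = u ∧ Valued.v (z - 1) ≤ Valued.v (u - 1)) [Fintype 𝓀[K]] [DecidableEq 𝓀[K]]
    -- the torus datum: σ-fixed INTEGERS `u₀ u₁ u₂` (units), `ε` (a unit, residually a non-square), `c₀` (a unit, the rank-one class constant)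
    (u₀ u₁ u₂ ε c₀ : 𝒪[K]) (hu₀ : Valued.v (u₀ : K) = 1) (hu₁ : Valued.v (u₁ : K) = 1) (hu₂ : Valued.v (u₂ : K) = 1) (hεv : Valued.v (ε : K) = 1) (hc₀ : Valued.v (c₀ : K) = 1)
    (hσu₀ : σ u₀ = u₀) (hσu₁ : σ u₁ = u₁) (hσu₂ : σ u₂ = u₂) (hσε : σ ε = ε) (hσc₀ : σ c₀ = c₀)
    (hε : ¬ IsSquare (IsLocalRing.residue 𝒪[K] ε))
    -- the element: norm-one diagonal entries, `v`-deep (`≡ 1 (ϖ²)`), depths `N₁ = depth(α − u)`, `N₂ = depth(u − γ)` (`N₁ + N₂ = 2m`), `N = depth(α − γ) = 2n+1`, `n ≥ 1`,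
    -- with the LEADING COEFFICIENTS `A = (α − u)∕ϖ^{N₁}`, `C = (γ − u)∕ϖ^{N₂}` (integers, units by `hN₁`, `hN₂`) that enter the sign
    (α u γ : K) (hα : α * σ α = 1) (hu : u * σ u = 1) (hγ : γ * σ γ = 1)
    (hα2 : Valued.v (α - 1) ≤ Valued.v ϖ ^ 2) (hu2 : Valued.v (u - 1) ≤ Valued.v ϖ ^ 2) (hγ2 : Valued.v (γ - 1) ≤ Valued.v ϖ ^ 2)
    (T : GL (Fin 3) K) (hT : (T : Matrix (Fin 3) (Fin 3) K) = Matrix.diagonal ![α, u, γ])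
    (N₁ N₂ N m n : ℕ) (hN₁ : Valued.v (α - u) = Valued.v ϖ ^ N₁) (hN₂ : Valued.v (u - γ) = Valued.v ϖ ^ N₂) (hN : Valued.v (α - γ) = Valued.v ϖ ^ N)
    (hm : N₁ + N₂ = 2 * m) (hn : N = 2 * n + 1) (h1n : 1 ≤ n)
    (A C : 𝒪[K]) (hA : α - u = (A : K) * ϖ ^ N₁) (hC : γ - u = (C : K) * ϖ ^ N₂) :
    ∀ j : Fin 5,
      ∑ b : Fin 2 × Fin 2, (-1 : ℚ) ^ (b.2 : ℕ) *
        (({M : Submodule 𝒪[K] (Fin 3 → K) |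
            IsSelfDualLattice σ ϖ (Matrix.diagonal ![((ε : K)) ^ (b.1 : ℕ) * (u₀ : K), (ε : K) ^ (b.2 : ℕ) * (u₁ : K), (ε : K) ^ ((b.1 : ℕ) + (b.2 : ℕ)) * (u₂ : K)]) M ∧ mapGL T M = M ∧
              (![-- bd : `¬ (T − 1)M ⊆ ϖM`
                  ¬ M.map ((Matrix.toLin' ((T : Matrix (Fin 3) (Fin 3) K) - 1)).restrictScalars 𝒪[K]) ≤ scaleLattice ϖ M,
                -- reg : depth 1, rank 2
                  M.map ((Matrix.toLin' ((T : Matrix (Fin 3) (Fin 3) K) - 1)).restrictScalars 𝒪[K]) ≤ scaleLattice ϖ M ∧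
                    ¬ M.map ((Matrix.toLin' ((T : Matrix (Fin 3) (Fin 3) K) - 1)).restrictScalars 𝒪[K]) ≤ scaleLattice (ϖ ^ 2) M ∧
                    ¬ M.map ((Matrix.toLin' (((T : Matrix (Fin 3) (Fin 3) K) - 1) ^ 2)).restrictScalars 𝒪[K]) ≤ scaleLattice (ϖ ^ 3) M,
                -- 1s : depth 1, rank 1, class `c₀`
                  M.map ((Matrix.toLin' ((T : Matrix (Fin 3) (Fin 3) K) - 1)).restrictScalars 𝒪[K]) ≤ scaleLattice ϖ M ∧
                    ¬ M.map ((Matrix.toLin' ((T : Matrix (Fin 3) (Fin 3) K) - 1)).restrictScalars 𝒪[K]) ≤ scaleLattice (ϖ ^ 2) M ∧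
                    M.map ((Matrix.toLin' (((T : Matrix (Fin 3) (Fin 3) K) - 1) ^ 2)).restrictScalars 𝒪[K]) ≤ scaleLattice (ϖ ^ 3) M ∧
                    ∃ y ∈ M, ∃ a : K, Valued.v a = 1 ∧
                      Valued.v (ϖ⁻¹ * pairing σ (Matrix.diagonal ![((ε : K)) ^ (b.1 : ℕ) * (u₀ : K), (ε : K) ^ (b.2 : ℕ) * (u₁ : K), (ε : K) ^ ((b.1 : ℕ) + (b.2 : ℕ)) * (u₂ : K)]) y
                        (((T : Matrix (Fin 3) (Fin 3) K) - 1) *ᵥ y) - (c₀ : K) * a ^ 2) < 1,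
                -- 1n : depth 1, rank 1, class `c₀·ε`
                  M.map ((Matrix.toLin' ((T : Matrix (Fin 3) (Fin 3) K) - 1)).restrictScalars 𝒪[K]) ≤ scaleLattice ϖ M ∧
                    ¬ M.map ((Matrix.toLin' ((T : Matrix (Fin 3) (Fin 3) K) - 1)).restrictScalars 𝒪[K]) ≤ scaleLattice (ϖ ^ 2) M ∧
                    M.map ((Matrix.toLin' (((T : Matrix (Fin 3) (Fin 3) K) - 1) ^ 2)).restrictScalars 𝒪[K]) ≤ scaleLattice (ϖ ^ 3) M ∧
                    ∃ y ∈ M, ∃ a : K, Valued.v a = 1 ∧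
                      Valued.v (ϖ⁻¹ * pairing σ (Matrix.diagonal ![((ε : K)) ^ (b.1 : ℕ) * (u₀ : K), (ε : K) ^ (b.2 : ℕ) * (u₁ : K), (ε : K) ^ ((b.1 : ℕ) + (b.2 : ℕ)) * (u₂ : K)]) y
                        (((T : Matrix (Fin 3) (Fin 3) K) - 1) *ᵥ y) - (c₀ : K) * (ε : K) * a ^ 2) < 1,
                -- 0 : depth ≥ 2
                  M.map ((Matrix.toLin' ((T : Matrix (Fin 3) (Fin 3) K) - 1)).restrictScalars 𝒪[K]) ≤ scaleLattice (ϖ ^ 2) M] : Fin 5 → Prop) j}.ncard : ℕ) : ℚ) =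
        ((quadraticChar 𝓀[K] (IsLocalRing.residue 𝒪[K] ((-1) ^ m * (u₀ * u₂ * A * C))) : ℤ) : ℚ) * (Fintype.card 𝓀[K] : ℚ) ^ m *
          (![4 * (Fintype.card 𝓀[K] : ℚ) ^ n, 4 * (Fintype.card 𝓀[K] : ℚ) ^ (n - 1), (2 * ((Fintype.card 𝓀[K] : ℚ) ^ n - Fintype.card 𝓀[K] - 1)) / (Fintype.card 𝓀[K] : ℚ) ^ 2,
              (2 * ((Fintype.card 𝓀[K] : ℚ) ^ n - Fintype.card 𝓀[K] - 1)) / (Fintype.card 𝓀[K] : ℚ) ^ 2,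
              (4 * ((Fintype.card 𝓀[K] : ℚ) ^ n - 1)) / (((Fintype.card 𝓀[K] : ℚ) - 1) * (Fintype.card 𝓀[K] : ℚ) ^ 2)] : Fin 5 → ℚ) j := by
  by_cases hconf : N₁ = N ∧ N₂ = N
  · exact signedStrataCount_typeOne_ram_equilateral_of_strataCount @TypeOneRamifiedJunction.strataCount_J₀_equilateral
      hσ hvσ hϖ hσϖ hres h2 hnorm u₀ u₁ u₂ ε c₀ hu₀ hu₁ hu₂ hεv hc₀ hσu₀ hσu₁ hσu₂ hσε hσc₀ hε α u γ hα hu hγ hα2 hu2 hγ2 T hT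
      N₁ N₂ N m n hN₁ hN₂ hN hm hn h1n A C hA hC hconf
  · exact signedStrataCount_typeOne_ram_isoceles_of_strataCount
      hσ hvσ hϖ hσϖ hres h2 hnorm u₀ u₁ u₂ ε c₀ hu₀ hu₁ hu₂ hεv hc₀ hσu₀ hσu₁ hσu₂ hσε hσc₀ hε α u γ hα hu hγ hα2 hu2 hγ2 T hT
      N₁ N₂ N m n hN₁ hN₂ hN hm hn h1n A C hA hC
      (@TypeOneRamifiedJunction.strataCount_J₀_isoceles K _ _ σ ϖ) @hHyp (@isoceles_bare_regionCard_and_tokenCounts K _ _ σ ϖ) hconf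

end Literature.NumberTheory.Rogawski1990

end
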